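import Mathlib.Data.List.GetD
import Literature.NumberTheory.DiophantineGeometry.GLHighestWeight
import HarnessLib

/-!
# Discharged facts: elementary properties of the weight of a partition; `Sym^m` is polynomial

`Literature.NumberTheory.DiophantineGeometry.GLHighestWeight` records, next to the genuine
highest-weight theorems for `GL_n`, five *elementary* statements about the weight
`Weight.ofPartition N μ = (μ₁, …, μ_N)` of a partition as named facts (`def … : Prop`). All five
are proved here, so that users holding `(h : Weight.size_ofPartition)` etc. can discharge
the hypothesis by `Weight.size_ofPartition_holds`:

* `Weight.isDominant_dual_iff_holds` — duality `χ ↦ (-χ_{N-1-i})_i` preserves dominance;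
* `Weight.isPolynomial_ofPartition_holds` — the weight of a partition is dominant and
  nonnegative (also for the truncated junk case);
* `Weight.size_ofPartition_holds` — if `μ ⊢ d` has at most `N` parts,
  `∑ i, (ofPartition N μ) i = d`;
* `Weight.ofPartition_injOn_holds` — `μ ↦ ofPartition N μ` is injective on partitions with at
  most `N` parts;
* `Weight.existsUnique_eq_ofPartition_holds` — every polynomial weight is the weight of exactly
  one partition of its size with at most `N` parts (the multiset of its positive entries).

A sixth elementary named fact of that file is discharged in the last section:

* `isPolynomialRep_formRep_holds` — the representation `formRep σ k m = Sym^m(k^σ)` of `GL σ k`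
  by linear substitution of variables on forms of degree `m` is a polynomial representation
  (`IsPolynomialRep`: every matrix coefficient `g ↦ φ (g · v)` is a polynomial in the entries of
  `g`). This is a definition chase: the substitution `X i ↦ ∑ j, g j i • X j` is the
  specialisation `X_{(a,b)} ↦ g a b` of one *generic* substitution with coefficients in
  `k[X_{(a,b)}]` (`exists_linSubst_eq_map_eval`), so every coefficient of `g · f`, hence every
  linear functional of it, is a polynomial in the `g a b` (Green, LNM 830, §2.2 and (2.6a)–(2.6c):
  the symmetric powers of the natural module are objects of `M_K(n,r)`; no hypothesis on `k`).

The proofs live in a separate file because `GLHighestWeight.lean` (definitions, review-queued)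
was migrated with its textbook facts in named-fact form.
The partition statements are elementary manipulations of sorted lists (Fulton–Harris,
*Representation Theory*, GTM 129, §15.5, notation only).

## References

* W. Fulton, J. Harris, *Representation Theory. A First Course*, GTM 129 (1991), §15.5.
* J. A. Green, *Polynomial Representations of `GL_n`*, LNM 830 (1980), §2.2, §2.6.
-/

open scoped BigOperators

namespace Literature.NumberTheory.DiophantineGeometry.Weight

/-- Dominance (antitonicity) is preserved by the duality `χ*(i) = -χ(N-1-i)`: `Fin.rev` is
antitone and negation reverses inequalities. [folklore] -/
theorem IsDominant.dual {N : ℕ} {χ : Weight (Fin N)} (h : χ.IsDominant) : χ.dual.IsDominant :=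
  fun _ _ hij => neg_le_neg (h (Fin.rev_le_rev.mpr hij))

/-- Discharge of the named fact `Weight.isDominant_dual_iff`: a weight is dominant iff its dual
is (from `IsDominant.dual` and the involutivity `dual_dual`). [folklore] -/
theorem isDominant_dual_iff_holds : isDominant_dual_iff :=
  fun χ => ⟨fun h => by simpa using h.dual, IsDominant.dual⟩

/-- Unfolding lemma: the `i`-th entry of the weight of `μ` is the `i`-th sorted part of `μ`
(zero beyond the number of parts). [folklore] -/
theorem ofPartition_apply (N : ℕ) {d : ℕ} (μ : Nat.Partition d) (i : Fin N) :
    ofPartition N μ i = ((μ.sortedParts.getD i 0 : ℕ) : ℤ) := rfl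

/-- Discharge of the named fact `Weight.isPolynomial_ofPartition`: the weight of a partition is
dominant (the sorted parts are weakly decreasing, and the zero padding is below every part) and
has nonnegative entries. [folklore] -/
theorem isPolynomial_ofPartition_holds : isPolynomial_ofPartition := by
  intro N d μ
  refine ⟨fun i j hij => ?_, fun i => by simp [ofPartition_apply]⟩
  simp only [ofPartition_apply, Nat.cast_le]
  by_cases hj : (j : ℕ) < μ.sortedParts.length
  · rw [List.getD_eq_getElem _ _ hj, List.getD_eq_getElem _ _ (lt_of_le_of_lt hij hj)]
    exact List.sortedGE_iff_getElem_ge_getElem_of_le.mp μ.sortedGE_sortedParts hij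
  · rw [List.getD_eq_default _ _ (not_lt.mp hj)]
    exact Nat.zero_le _

/-- Summing the zero-padded entries of a list of naturals over `Fin N`, `N ≥ length`, gives the
sum of the list. [folklore] -/
theorem sum_getD_cast_eq {N : ℕ} (l : List ℕ) (hl : l.length ≤ N) :
    ∑ i : Fin N, ((l.getD i 0 : ℕ) : ℤ) = (l.sum : ℤ) := by
  rw [Fin.sum_univ_eq_sum_range (fun n => ((l.getD n 0 : ℕ) : ℤ)) N,
    ← Finset.sum_subset (Finset.range_subset_range.mpr hl) fun n _ hn => by
      rw [List.getD_eq_default _ _ (not_lt.mp (by simpa using hn)), Nat.cast_zero],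
    ← Fin.sum_univ_eq_sum_range (fun n => ((l.getD n 0 : ℕ) : ℤ)), Nat.cast_list_sum,
    ← Fin.sum_univ_fun_getElem]
  exact Finset.sum_congr rfl fun i _ => by rw [List.getD_eq_getElem _ _ i.2]

/-- Discharge of the named fact `Weight.size_ofPartition`: the weight of `μ ⊢ d` with at most
`N` parts has size `∑ i, μ_i = d`. [folklore] -/
theorem size_ofPartition_holds : size_ofPartition := by
  intro N d μ hμ
  change ∑ i : Fin N, ((μ.sortedParts.getD i 0 : ℕ) : ℤ) = d
  rw [sum_getD_cast_eq _ (by simpa using hμ), μ.sum_sortedParts]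

/-- If two partitions with `ν` having at most `N` parts have the same weight in `GL_N`, then `ν`
has at most as many parts as `μ` (otherwise the weight of `μ` vanishes at index `#parts(μ)` while
that of `ν` is a positive part). [folklore] -/
theorem length_sortedParts_le_of_ofPartition_eq {N d : ℕ} {μ ν : Nat.Partition d}
    (h : ofPartition N μ = ofPartition N ν) (hν : ν.parts.card ≤ N) :
    ν.sortedParts.length ≤ μ.sortedParts.length := by
  by_contra hlt
  rw [not_le] at hlt
  have hi : μ.sortedParts.length < N := lt_of_lt_of_le hlt (by simpa using hν)
  have key := congrFun h ⟨μ.sortedParts.length, hi⟩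
  simp only [ofPartition_apply, Nat.cast_inj, List.getD_eq_default _ _ le_rfl,
    List.getD_eq_getElem _ _ hlt] at key
  exact (ν.pos_of_mem_sortedParts (List.getElem_mem hlt)).ne key

/-- Two partitions with at most `N` parts and the same weight in `GL_N` have the same sorted
parts. [folklore] -/
theorem sortedParts_eq_of_ofPartition_eq {N d : ℕ} {μ ν : Nat.Partition d}
    (h : ofPartition N μ = ofPartition N ν) (hμ : μ.parts.card ≤ N) (hν : ν.parts.card ≤ N) :
    μ.sortedParts = ν.sortedParts := by
  have hlen : μ.sortedParts.length = ν.sortedParts.length :=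
    le_antisymm (length_sortedParts_le_of_ofPartition_eq h.symm hμ)
      (length_sortedParts_le_of_ofPartition_eq h hν)
  refine List.ext_getElem hlen fun i h₁ h₂ => ?_
  have hi : i < N := lt_of_lt_of_le h₁ (by simpa using hμ)
  have key := congrFun h ⟨i, hi⟩
  simpa only [ofPartition_apply, Nat.cast_inj, List.getD_eq_getElem _ _ h₁,
    List.getD_eq_getElem _ _ h₂] using key

/-- Discharge of the named fact `Weight.ofPartition_injOn`: `μ ↦ Weight.ofPartition N μ` is
injective on partitions of `d` with at most `N` parts (a partition is determined by its sorted
parts, `Multiset.sort_eq`). [folklore] -/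
theorem ofPartition_injOn_holds : ofPartition_injOn := by
  intro N d μ hμ ν hν h
  ext1
  rw [← Multiset.sort_eq μ.parts (· ≥ ·), ← Multiset.sort_eq ν.parts (· ≥ ·)]
  exact congrArg _ (sortedParts_eq_of_ofPartition_eq h hμ hν)

/-! ### Polynomial weights are weights of partitions -/

/-- Dropping the zero entries of a list of naturals does not change its sum. [folklore] -/
theorem sum_filter_pos : ∀ l : List ℕ, (l.filter (0 < ·)).sum = l.sum
  | [] => rfl
  | a :: l => by
    rw [List.filter_cons, List.sum_cons]
    by_cases ha : 0 < a
    · simp [ha, sum_filter_pos l]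
    · simp [Nat.eq_zero_of_not_pos ha, sum_filter_pos l]

/-- In a weakly decreasing list of naturals the zero entries form a suffix, so dropping them
does not change any zero-padded entry. [folklore] -/
theorem getD_filter_pos_of_pairwise :
    ∀ {l : List ℕ}, l.Pairwise (· ≥ ·) → ∀ i : ℕ, (l.filter (0 < ·)).getD i 0 = l.getD i 0
  | [], _, i => rfl
  | a :: l, h, i => by
    rw [List.pairwise_cons] at h
    rw [List.filter_cons]
    by_cases ha : 0 < a
    · cases i with
      | zero => simp [ha]
      | succ i => simpa [ha] using getD_filter_pos_of_pairwise h.2 i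
    · have ha0 : a = 0 := Nat.eq_zero_of_not_pos ha
      have hl : ∀ b ∈ l, b = 0 := fun b hb => Nat.le_zero.mp (ha0 ▸ h.1 b hb)
      have hnil : l.filter (0 < ·) = [] :=
        List.filter_eq_nil_iff.mpr fun b hb => by simp [hl b hb]
      simp only [ha, decide_false, Bool.false_eq_true, ↓reduceIte, hnil, List.getD_nil]
      cases i with
      | zero => simp [ha0]
      | succ i =>
        rw [List.getD_cons_succ]
        by_cases hi : i < l.length
        · rw [List.getD_eq_getElem _ _ hi, hl _ (List.getElem_mem hi)]
        · rw [List.getD_eq_default _ _ (not_lt.mp hi)]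

/-- Discharge of the named fact `Weight.existsUnique_eq_ofPartition`: a polynomial weight
`χ = (χ₀ ≥ χ₁ ≥ ⋯ ≥ χ_{N-1} ≥ 0)` of `GL_N` is the weight of exactly one partition of
`∑ i, χ i` with at most `N` parts, namely the multiset of its positive entries (existence), and
uniqueness is `Weight.ofPartition_injOn_holds`. Fulton–Harris §15.5 (notation). [folklore] -/
theorem existsUnique_eq_ofPartition_holds : existsUnique_eq_ofPartition := by
  intro N χ hχ
  classical
  -- the entries of `χ` as naturals, and the list of the positive ones
  set f : Fin N → ℕ := fun i => (χ i).toNat with hf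
  have hfχ : ∀ i, ((f i : ℕ) : ℤ) = χ i := fun i => Int.toNat_of_nonneg (hχ.2 i)
  have hanti : Antitone f := fun i j hij => Int.toNat_le_toNat (hχ.1 hij)
  have hsorted : (List.ofFn f).Pairwise (· ≥ ·) := hanti.sortedGE_ofFn.pairwise
  set L : List ℕ := (List.ofFn f).filter (0 < ·) with hL
  have hLsorted : L.Pairwise (· ≥ ·) := hsorted.filter _
  have hLsum : L.sum = χ.size.toNat := by
    apply Int.ofNat_injective
    simp only [Int.ofNat_eq_natCast]
    rw [hL, sum_filter_pos, List.sum_ofFn, Nat.cast_sum, size,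
      Int.toNat_of_nonneg (Finset.sum_nonneg fun i _ => hχ.2 i)]
    exact Finset.sum_congr rfl fun i _ => hfχ i
  -- the partition of the positive entries
  let μ : Nat.Partition χ.size.toNat :=
    { parts := (L : Multiset ℕ)
      parts_pos := fun hi => by
        obtain ⟨-, hi⟩ := List.mem_filter.mp (Multiset.mem_coe.mp hi)
        simpa using hi
      parts_sum := by rw [Multiset.sum_coe, hLsum] }
  have hμN : μ.parts.card ≤ N := by
    change (L : Multiset ℕ).card ≤ N
    rw [Multiset.coe_card, hL]
    exact (List.length_filter_le _ _).trans (List.length_ofFn (f := f)).le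
  have hsortedParts : μ.sortedParts = L := by
    change Multiset.sort (L : Multiset ℕ) (· ≥ ·) = L
    rw [Multiset.coe_sort]
    exact List.mergeSort_eq_self (r := (· ≥ ·)) hLsorted
  have hμχ : ofPartition N μ = χ := by
    funext i
    rw [ofPartition_apply, hsortedParts, hL, getD_filter_pos_of_pairwise hsorted,
      List.getD_eq_getElem _ _ (by simp), List.getElem_ofFn, ← hfχ]
  refine ⟨μ, ⟨hμN, hμχ⟩, fun ν hν => ?_⟩
  exact ofPartition_injOn_holds N _ hν.1 hμN (hν.2.trans hμχ.symm)

end Literature.NumberTheory.DiophantineGeometry.Weight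

/-! ### `formRep σ k m = Sym^m(k^σ)` is a polynomial representation -/

namespace Literature.NumberTheory.DiophantineGeometry

open MvPolynomial Literature.Computability.AlgebraicComplexity

section FormRepPolynomial

variable {σ k : Type*} [Fintype σ] [Field k]

/-- **Generic linear substitution.** For every polynomial `f ∈ k[X_σ]` there is a polynomial
`Q ∈ k[X_{(a,b)}][X_σ]` (the substitution of `f` by the generic matrix) such that for every
matrix `A` the substitution `X i ↦ ∑ j, A j i • X j` of `f` is `Q` with its coefficients
evaluated at `X_{(a,b)} = A a b`. Induction on `f`: constants, sums, and `f * X i`, where the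
generic image of `X i` is `∑ j, X_{(j,i)} X j`. Green, LNM 830, §2.2 (coefficient functions).
[folklore] -/
theorem exists_linSubst_eq_map_eval (f : MvPolynomial σ k) :
    ∃ Q : MvPolynomial σ (MvPolynomial (σ × σ) k), ∀ A : Matrix σ σ k,
      linSubst σ k A f = MvPolynomial.map (MvPolynomial.eval fun ij : σ × σ => A ij.1 ij.2) Q := by
  induction f using MvPolynomial.induction_on with
  | C a => exact ⟨C (C a), fun A => by rw [linSubst_C, map_C, eval_C]⟩
  | add p q hp hq =>
    obtain ⟨P, hP⟩ := hp
    obtain ⟨Q, hQ⟩ := hq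
    exact ⟨P + Q, fun A => by rw [map_add, map_add, hP, hQ]⟩
  | mul_X p i hp =>
    obtain ⟨P, hP⟩ := hp
    refine ⟨P * ∑ j, C (X (j, i)) * X j, fun A => ?_⟩
    rw [map_mul, map_mul, hP, linSubst_X, map_sum]
    congr 1
    refine Finset.sum_congr rfl fun j _ => ?_
    simp only [map_mul, map_C, map_X, eval_X, smul_eq_C_mul]

/-- **Matrix coefficients of the substitution representation are polynomial.** For every
polynomial `f` and every linear functional `ψ` on `k[X_σ]` there is a polynomial `P` in the
matrix entries with `ψ (A · f) = P(A)` for all matrices `A`: write the generic substitution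
`Q = ∑_n Q_n X^n` (`exists_linSubst_eq_map_eval`, `MvPolynomial.as_sum`); then
`ψ (A · f) = ∑_n Q_n(A) ψ(X^n)`, so `P = ∑_n Q_n · ψ(X^n)`. Green, LNM 830, §2.2. [folklore] -/
theorem exists_eval_eq_apply_linSubst (f : MvPolynomial σ k)
    (ψ : Module.Dual k (MvPolynomial σ k)) :
    ∃ P : MvPolynomial (σ × σ) k, ∀ A : Matrix σ σ k,
      ψ (linSubst σ k A f) = MvPolynomial.eval (fun ij : σ × σ => A ij.1 ij.2) P := by
  obtain ⟨Q, hQ⟩ := exists_linSubst_eq_map_eval f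
  refine ⟨∑ n ∈ Q.support, Q.coeff n * C (ψ (monomial n 1)), fun A => ?_⟩
  have hmono : ∀ (n : σ →₀ ℕ) (c : k), ψ (monomial n c) = c * ψ (monomial n 1) := fun n c => by
    rw [show monomial n c = c • monomial n (1 : k) by rw [smul_monomial, smul_eq_mul, mul_one],
      map_smul, smul_eq_mul]
  rw [hQ A]
  conv_lhs => rw [Q.as_sum, map_sum, map_sum]
  rw [map_sum]
  refine Finset.sum_congr rfl fun n _ => ?_
  rw [map_monomial, hmono, map_mul, eval_C]

/-- **Discharge of `isPolynomialRep_formRep`** (`GLHighestWeight.lean`): the representation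
`formRep σ k m = Sym^m(k^σ)` of `GL σ k` on forms of degree `m` is a polynomial representation —
a matrix coefficient `g ↦ φ (g · v)` equals `g ↦ ψ (g · v)` for any linear extension `ψ` of `φ`
from the forms of degree `m` to all polynomials (Mathlib `LinearMap.exists_extend`), which is a
polynomial in the entries of `g` by `exists_eval_eq_apply_linSubst`. Green, LNM 830, §2.2 with
(2.6a)–(2.6c) (symmetric powers of the natural module lie in `M_K(n,r)`); no hypothesis on the
field. [folklore] -/
theorem isPolynomialRep_formRep_holds [LinearOrder σ] :
    isPolynomialRep_formRep (σ := σ) (k := k) := by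
  intro m v φ
  obtain ⟨ψ, hψ⟩ := LinearMap.exists_extend φ
  obtain ⟨P, hP⟩ := exists_eval_eq_apply_linSubst (v : MvPolynomial σ k) ψ
  refine ⟨P, fun g => ?_⟩
  rw [← hP (g : Matrix σ σ k), ← hψ]
  rfl

end FormRepPolynomial

end Literature.NumberTheory.DiophantineGeometry
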